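import Mathlib.LinearAlgebra.BilinearForm.Orthogonal
import Literature.Algebra.Lie.LefschetzModuleInvariantFormIrreducible
import Literature.Algebra.Lie.LefschetzModulePolarization
import HarnessLib

/-!
# Perpendicular splitting of a Lefschetz module with an invariant form along a stable subspace (Looijenga–Lunts 1997, §1 (1.3))

Topic `Literature/Algebra/Lie` (namespace `Literature.Algebra.Lie`).  Lane `lit-hodgefound` (Track 2 foundations
library), skeleton seat `lit-hodgefound-skel-1` (generation 43), row **A1-126** of
`run/shared/lean/pub/lit-hodgefound/SKELETON.md`: the ENGINE of the second half of the third sentence of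
Looijenga–Lunts' (1.3) — "any Lefschetz module with nondegenerate bilinear form is the perpendicular direct sum of
Lefschetz modules that are irreducible orthogonal, irreducible symplectic, or the direct sum of an irreducible
Lefschetz module with its dual" — namely the four steps of its (unprinted, standard) proof: (i) the orthogonal `N^⊥` of a
`𝔤(𝔞, M)`-stable subspace `N` is `𝔤(𝔞, M)`-stable; (ii) on an irreducible stable subspace the restricted form is
either non-degenerate or identically zero; (iii) when the restriction to `N` is non-degenerate, `M = N ⊕ N^⊥` is a
perpendicular splitting into stable subspaces and the restriction to `N^⊥` is again non-degenerate (so the splitting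
can be iterated); (iv) when `N` is isotropic, a stable complement `C` of `N^⊥` (Weyl) gives a stable `N ⊕ C` on which
`φ` is non-degenerate ("the direct sum of an irreducible Lefschetz module with its dual"), split off by (iii).  THEOREMS ONLY on top of A1-96 / A1-97 /
A1-120, the tree's Weyl theorem, and Mathlib's `LinearMap.BilinForm.orthogonal`; no definition, no named fact, no `sorry` (D-0026 net debt `0`).

## Source, VERBATIM

E. Looijenga, V. A. Lunts, *A Lie algebra attached to a projective variety*, Invent. Math. **129** (1997) 361–412,
§1 (1.3) (held TeX text `paper:arxiv-alg-geom_9604014`, p0005 L9–L16):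

> "If `φ` is nondegenerate and symmetric (resp. skew-symmetric), then we call `(M, φ)` an orthogonal
> (resp. symplectic) representation. Since a nonzero invariant bilinear form on an irreducible representation is
> either orthogonal or symplectic, any Lefschetz module with nondegenerate bilinear form is the perpendicular direct
> sum of Lefschetz modules that are irreducible orthogonal, irreducible symplectic, or the direct sum of an
> irreducible Lefschetz module with its dual."

## Rendering (dictionary)

* "Lefschetz module with (nondegenerate) bilinear form": `(M, h)`, `𝔞 ⊆ 𝔤𝔩(M)`, `φ : LinearMap.BilinForm K M` with
  `φ.IsSkewAdjoint h` and `φ.IsSkewAdjoint a` for `a ∈ 𝔞` (then all of `𝔤(𝔞, M)` is `φ`-skew, A1-97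
  `isSkewAdjoint_of_mem_lefschetzLieAlgebra'`); the theorems of §1 are stated for an arbitrary operator `x` that is
  `φ`-skew, those of §2–§3 for `𝔤(𝔞, M)`.  "perpendicular": Mathlib `LinearMap.BilinForm.orthogonal φ N`
  (`= {m | ∀ n ∈ N, φ n m = 0}`) and `IsCompl N (φ.orthogonal N)`; REFLEXIVITY `φ.IsRefl` (which holds for the
  symmetric / skew forms of the source) is assumed where left and right orthogonals must agree.
* "sub-Lefschetz-module" / stable subspace: a `Submodule K M` mapped into itself by every `x ∈ 𝔤(𝔞, M)`;
  "irreducible" stable subspace: its only stable subspaces are `⊥` and itself (as in A1-103/A1-120,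
  `isIrreducible_iff_forall_stable`).

## Contents (all proved)

* §1 **`orthogonal_stable`** (`N` stable under `𝔤(𝔞, M)` ⟹ `N^⊥` stable; the elementwise step is A1-96
  `apply_mem_orthogonal_of_isSkewAdjoint`, reused).
* §2 **`restrict_nondegenerate_or_forall_apply_eq_zero`** (`N` stable and irreducible, `φ` reflexive ⟹
  `(φ.restrict N).Nondegenerate` or `φ(N, N) = 0`: the radical `N ∩ N^⊥` is stable).
* §3 **`isCompl_orthogonal_of_stable`** (`φ` reflexive, `φ|_N` non-degenerate ⟹ `M = N ⊕ N^⊥`, both stable — the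
  "perpendicular direct sum" step) and **`restrict_orthogonal_nondegenerate`** (`φ` non-degenerate and reflexive,
  `φ|_N` non-degenerate ⟹ `φ|_{N^⊥}` non-degenerate — the splitting iterates).
* §4 **`IsLefschetzModule.exists_stable_compl_of_isotropic`** (the ISOTROPIC step: for `N` stable with `φ(N, N) = 0`
  in a Lefschetz module — complete reducibility, the tree's Weyl `exists_isCompl_lieSubmodule_of_isSemisimple` — a
  stable complement `C` of `N^⊥` exists, `N ∩ C = 0` and `φ|_{N ⊕ C}` is non-degenerate; `C ≅ N^*`).

## SCOPE

(a) The ASSEMBLED decomposition (the induction on `dim M` combining §2–§4 into "the perpendicular direct sum of …")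
is NOT formalised here, only its steps; (b) "orthogonal or symplectic" for the non-degenerate irreducible summands is
A1-120 (`[IsAlgClosed K]`) / A1-124 (line `𝔞`); (c) nothing here concerns complex tori or the Hodge conjecture.

## References

* [LooijengaLunts1997] E. Looijenga, V. A. Lunts, *A Lie algebra attached to a projective variety*, Invent. Math. 129
  (1997) 361–412; arXiv:alg-geom/9604014. §1 (1.3), p. 5 L9–L16 of the held TeX text.
-/

namespace Literature.Algebra.Lie

open Module Function Set
open LinearMap (BilinForm)

-- The commutator Lie ring of `𝔤𝔩(M) = Module.End K M`: Mathlib's reducible NON-instance, enabled file-locally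
-- exactly as in `LefschetzModule.lean`.
attribute [local instance 100] LieRing.ofAssociativeRing

/-! ### §1 The orthogonal of a stable subspace is stable -/

section Orthogonal

variable {K : Type*} [Field K] {M : Type*} [AddCommGroup M] [Module K M] {B : BilinForm K M} {N : Submodule K M}

variable [CharZero K] [FiniteDimensional K M] {h : Module.End K M} {𝔞 : Submodule K (Module.End K M)}

/-- **The orthogonal `N^⊥` of a `𝔤(𝔞, M)`-stable subspace `N` is `𝔤(𝔞, M)`-stable** (for an invariant form:
`h`- and `𝔞`-skew, hence skew for all of `𝔤(𝔞, M)` by A1-97; elementwise step = A1-96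
`apply_mem_orthogonal_of_isSkewAdjoint`, i.e. the `lie_mem` of Mathlib's `LieAlgebra.InvariantForm.orthogonal`).
[cite: LooijengaLunts1997, §1 (1.3) p0005 L8–L16] -/
theorem orthogonal_stable (hh : B.IsSkewAdjoint h) (h𝔞 : ∀ a ∈ 𝔞, B.IsSkewAdjoint a)
    (hN : ∀ x ∈ lefschetzLieAlgebra K h 𝔞, ∀ n ∈ N, x n ∈ N) :
    ∀ x ∈ lefschetzLieAlgebra K h 𝔞, ∀ m ∈ B.orthogonal N, x m ∈ B.orthogonal N :=
  fun x hx _ hm ↦ apply_mem_orthogonal_of_isSkewAdjoint (isSkewAdjoint_of_mem_lefschetzLieAlgebra' hh h𝔞 hx) (hN x hx) hm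

end Orthogonal

/-! ### §2 On an irreducible stable subspace the form is non-degenerate or zero -/

section Irreducible

variable {K : Type*} [Field K] [CharZero K] {M : Type*} [AddCommGroup M] [Module K M] [FiniteDimensional K M]
  {B : BilinForm K M} {h : Module.End K M} {𝔞 : Submodule K (Module.End K M)} {N : Submodule K M}

/-- **On an irreducible `𝔤(𝔞, M)`-stable subspace `N` a reflexive invariant form is either non-degenerate or
identically zero**: the radical `N ∩ N^⊥` of `φ|_N` is stable (§1), hence `⊥` (then `φ|_N` is non-degenerate, Mathlib
`nondegenerate_restrict_of_disjoint_orthogonal`) or `N` (then `φ(N, N) = 0`).  This is the dichotomy behind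
"irreducible orthogonal, irreducible symplectic, or [isotropic, paired with its dual]".
[cite: LooijengaLunts1997, §1 (1.3) p0005 L10–L16] -/
theorem restrict_nondegenerate_or_forall_apply_eq_zero (hr : B.IsRefl) (hh : B.IsSkewAdjoint h)
    (h𝔞 : ∀ a ∈ 𝔞, B.IsSkewAdjoint a) (hN : ∀ x ∈ lefschetzLieAlgebra K h 𝔞, ∀ n ∈ N, x n ∈ N)
    (hirr : ∀ N' : Submodule K M, N' ≤ N → (∀ x ∈ lefschetzLieAlgebra K h 𝔞, ∀ n ∈ N', x n ∈ N') → N' = ⊥ ∨ N' = N) :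
    (B.restrict N).Nondegenerate ∨ ∀ x ∈ N, ∀ y ∈ N, B x y = 0 := by
  rcases hirr (N ⊓ B.orthogonal N) inf_le_left (fun x hx n hn ↦
      ⟨hN x hx n hn.1, orthogonal_stable hh h𝔞 hN x hx n hn.2⟩) with h1 | h1
  · left
    exact LinearMap.BilinForm.nondegenerate_restrict_of_disjoint_orthogonal B hr (disjoint_iff.2 h1)
  · right
    intro x hx y hy
    have hy' : y ∈ B.orthogonal N := (h1.symm ▸ hy : y ∈ N ⊓ B.orthogonal N).2
    rw [LinearMap.BilinForm.mem_orthogonal_iff] at hy'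
    exact hy' x hx

end Irreducible

/-! ### §3 Perpendicular splitting along a stable subspace with non-degenerate restriction -/

section Splitting

variable {K : Type*} [Field K] [CharZero K] {M : Type*} [AddCommGroup M] [Module K M] [FiniteDimensional K M]
  {B : BilinForm K M} {h : Module.End K M} {𝔞 : Submodule K (Module.End K M)} {N : Submodule K M}

/-- **"perpendicular direct sum": `M = N ⊕ N^⊥` with both summands `𝔤(𝔞, M)`-stable**, for `N` stable with
`φ|_N` non-degenerate and `φ` reflexive (Mathlib `isCompl_orthogonal_of_restrict_nondegenerate` + §1).
[cite: LooijengaLunts1997, §1 (1.3) p0005 L11–L16] -/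
theorem isCompl_orthogonal_of_stable (hr : B.IsRefl) (hh : B.IsSkewAdjoint h) (h𝔞 : ∀ a ∈ 𝔞, B.IsSkewAdjoint a)
    (hN : ∀ x ∈ lefschetzLieAlgebra K h 𝔞, ∀ n ∈ N, x n ∈ N) (hnd : (B.restrict N).Nondegenerate) :
    IsCompl N (B.orthogonal N) ∧ ∀ x ∈ lefschetzLieAlgebra K h 𝔞, ∀ m ∈ B.orthogonal N, x m ∈ B.orthogonal N :=
  ⟨LinearMap.BilinForm.isCompl_orthogonal_of_restrict_nondegenerate hr hnd, orthogonal_stable hh h𝔞 hN⟩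

omit [CharZero K] in
/-- **The splitting iterates: `φ|_{N^⊥}` is non-degenerate** when `φ` is non-degenerate and reflexive and `φ|_N` is
non-degenerate (`N^⊥ ∩ N^⊥⊥ = N^⊥ ∩ N = 0`). [cite: LooijengaLunts1997, §1 (1.3) p0005 L11–L16] -/
theorem restrict_orthogonal_nondegenerate (hB : B.Nondegenerate) (hr : B.IsRefl)
    (hnd : (B.restrict N).Nondegenerate) : (B.restrict (B.orthogonal N)).Nondegenerate := by
  refine LinearMap.BilinForm.nondegenerate_restrict_of_disjoint_orthogonal B hr ?_
  rw [LinearMap.BilinForm.orthogonal_orthogonal hB hr]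
  exact (LinearMap.BilinForm.isCompl_orthogonal_of_restrict_nondegenerate hr hnd).symm.disjoint

end Splitting

/-! ### §4 The isotropic case: a stable complement of `N^⊥` pairs with `N` non-degenerately -/

section Isotropic

variable {K : Type*} [Field K] [CharZero K] {M : Type*} [AddCommGroup M] [Module K M] [FiniteDimensional K M]
  {B : BilinForm K M} {h : Module.End K M} {𝔞 : Submodule K (Module.End K M)} {N : Submodule K M}

/-- **The isotropic step of the perpendicular decomposition.**  In a Lefschetz module `(𝔞, M)` (so that `M` is
completely reducible under the semisimple `𝔤(𝔞, M)` — Weyl, the tree's `exists_isCompl_lieSubmodule_of_isSemisimple`)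
with a non-degenerate reflexive invariant form `φ`, let `N` be a stable subspace which is totally ISOTROPIC
(`φ(N, N) = 0`, e.g. an irreducible stable subspace on which `φ` is not non-degenerate, §2).  Then a stable
complement `C` of the stable subspace `N^⊥` exists, `N ∩ C = 0`, and `φ` is NON-DEGENERATE on `N ⊕ C` (which is
therefore split off perpendicularly by §3; as a `𝔤(𝔞, M)`-module `C ≅ M/N^⊥ ≅ N^*` — "the direct sum of an
irreducible Lefschetz module with its dual" when `N` is irreducible). [cite: LooijengaLunts1997, §1 (1.3) p0005 L11–L16] [cite: LooijengaLunts1997, §1 (1.2) p0004 L65–L68 ("any representation of a semisimple Lie algebra is reductive")] -/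
theorem IsLefschetzModule.exists_stable_compl_of_isotropic (A : IsLefschetzModule K h 𝔞) (hB : B.Nondegenerate)
    (hr : B.IsRefl) (hh : B.IsSkewAdjoint h) (h𝔞 : ∀ a ∈ 𝔞, B.IsSkewAdjoint a)
    (hN : ∀ x ∈ lefschetzLieAlgebra K h 𝔞, ∀ n ∈ N, x n ∈ N) (hiso : ∀ x ∈ N, ∀ y ∈ N, B x y = 0) :
    ∃ C : Submodule K M, (∀ x ∈ lefschetzLieAlgebra K h 𝔞, ∀ c ∈ C, x c ∈ C) ∧ IsCompl (B.orthogonal N) C ∧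
      N ⊓ C = ⊥ ∧ (B.restrict (N ⊔ C)).Nondegenerate := by
  classical
  haveI := A.isSemisimple
  haveI : FiniteDimensional K (lefschetzLieAlgebra K h 𝔞) :=
    inferInstanceAs (FiniteDimensional K (lefschetzLieAlgebra K h 𝔞).toSubmodule)
  have hNo := orthogonal_stable hh h𝔞 hN
  -- Weyl: a stable complement `C` of the stable subspace `N^⊥`
  let P : LieSubmodule K (lefschetzLieAlgebra K h 𝔞) M :=
    { B.orthogonal N with
      lie_mem := fun {x m} hm ↦ by
        rw [LieSubalgebra.coe_bracket_of_module, Module.End.lie_apply]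
        exact hNo x.1 x.2 m hm }
  obtain ⟨C', hPC'⟩ := exists_isCompl_lieSubmodule_of_isSemisimple (k := K) P
  have hC : ∀ x ∈ lefschetzLieAlgebra K h 𝔞, ∀ c ∈ (C' : Submodule K M), x c ∈ (C' : Submodule K M) := by
    intro x hx c hc
    have h1 := C'.lie_mem (x := ⟨x, hx⟩) hc
    rwa [LieSubalgebra.coe_bracket_of_module, Module.End.lie_apply] at h1
  have hinf : B.orthogonal N ⊓ (C' : Submodule K M) = ⊥ := by
    have := hPC'.inf_eq_bot
    rw [← LieSubmodule.toSubmodule_inj, LieSubmodule.inf_toSubmodule, LieSubmodule.bot_toSubmodule] at this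
    exact this
  have hsup : B.orthogonal N ⊔ (C' : Submodule K M) = ⊤ := by
    have := hPC'.sup_eq_top
    rw [← LieSubmodule.toSubmodule_inj, LieSubmodule.sup_toSubmodule, LieSubmodule.top_toSubmodule] at this
    exact this
  have hcompl : IsCompl (B.orthogonal N) (C' : Submodule K M) :=
    ⟨disjoint_iff.2 hinf, codisjoint_iff.2 hsup⟩
  -- `N ⊆ N^⊥` (isotropic), so `N ∩ C = 0`
  have hNle : N ≤ B.orthogonal N := fun y hy ↦ by
    rw [LinearMap.BilinForm.mem_orthogonal_iff]
    intro n hn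
    exact hiso n hn y hy
  have hNC : N ⊓ (C' : Submodule K M) = ⊥ := by
    rw [eq_bot_iff, ← hinf]
    exact inf_le_inf_right _ hNle
  refine ⟨C', hC, hcompl, hNC, ?_⟩
  -- non-degeneracy of `φ` on `N ⊕ C`
  have hleft : ∀ z ∈ N ⊔ (C' : Submodule K M), (∀ w ∈ N ⊔ (C' : Submodule K M), B z w = 0) → z = 0 := by
    intro z hz hzw
    obtain ⟨n, hn, c, hc, rfl⟩ := Submodule.mem_sup.1 hz
    -- `c ∈ N^⊥ ∩ C = 0`
    have hc0 : c = 0 := by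
      have hc' : c ∈ B.orthogonal N := by
        rw [LinearMap.BilinForm.mem_orthogonal_iff]
        intro m hm
        -- `φ(n + c, m) = 0` and `φ(n, m) = 0`, so `φ(c, m) = 0`, hence `φ(m, c) = 0`
        have h1 := hzw m (Submodule.mem_sup_left hm)
        rw [map_add, LinearMap.add_apply, hiso n hn m hm, zero_add] at h1
        exact hr c m h1
      have : c ∈ B.orthogonal N ⊓ (C' : Submodule K M) := ⟨hc', hc⟩
      rw [hinf, Submodule.mem_bot] at this
      exact this
    subst hc0
    rw [add_zero]
    -- `φ(n, ·)` vanishes on `N^⊥` and on `C`, hence on `M`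
    refine hB.1 n fun w ↦ ?_
    have hw : w ∈ B.orthogonal N ⊔ (C' : Submodule K M) := by rw [hsup]; exact Submodule.mem_top
    obtain ⟨w₁, hw₁, w₂, hw₂, rfl⟩ := Submodule.mem_sup.1 hw
    have h1 : B n w₁ = 0 := (LinearMap.BilinForm.mem_orthogonal_iff.1 hw₁) n hn
    have h2 : B n w₂ = 0 := by
      have := hzw w₂ (Submodule.mem_sup_right hw₂)
      rwa [add_zero] at this
    rw [map_add, h1, h2, add_zero]
  refine ⟨fun z hz ↦ Subtype.ext (hleft z z.2 fun w hw ↦ ?_), fun z hz ↦ Subtype.ext (hleft z z.2 fun w hw ↦ ?_)⟩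
  · exact hz ⟨w, hw⟩
  · exact hr _ _ (hz ⟨w, hw⟩)

end Isotropic

end Literature.Algebra.Lie
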